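import Summits.Parity.BatemanHorn.Theorems.SoloInformedHooleyMeanLocalCalibration

/-!
# The `ℓ¹`-mean hypothesis for Hooley sums: its pointwise content and its second-moment form

Informed soloist `solo-Parity-informed` (session 143), conjunct `BatemanHorn`, the `d ≥ 3` rung BELOW the parity
wall.  Two short clarifications of WHAT the hypothesis `HooleyMeanLocal g θ η` of `SoloInformedHooleyMeanLocal`
(consumed by `erdosDivisorSumAsymptotic_cubic_of_hooleyMeanLocal`, `SoloInformedTrapezoidCancellation`) asks.

* `HooleyMeanLocal.pointwise`: because the `ℓ¹` condition is imposed for EVERY `H ≤ E^θ`, it contains, for each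
  single frequency `1 ≤ h ≤ E^θ`, the POINTWISE bound `‖∑_{E<e≤E'} S_g(±h;e)‖ ≤ C·h·E^{1−η}`.  For bounded `h`
  this is a pointwise power saving over all moduli in dyadic ranges — Hooley's 1964 problem (where only a power
  of `log` is saved in print for `deg g ≥ 3`) with the specific exponent `η`; the averaging in `h` is a genuine
  weakening only in the regime `h → E^θ`, and frequencies beyond `E^θ` do not occur at all.
* `HooleyMeanSquareLocal g θ η`: the SECOND-MOMENT form `∑_{1≤h≤H} (‖∑_e S_g(h;e)‖² + ‖∑_e S_g(−h;e)‖²)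
  ≤ C·H·E^{2(1−η)}`, which implies the `ℓ¹` form with the same exponents by Cauchy–Schwarz
  (`hooleyMeanLocal_of_meanSquare`) and is implied by the uniform pointwise hypothesis
  (`hooleyMeanSquareLocal_of_unshiftedUniform`); expanding the square turns it into a statement about PAIR
  CORRELATIONS of the root fractions `ν/e` (`E < e ≤ E'`, `g(ν) ≡ 0 (mod e)`) at scale `1/H` — recorded here only
  as the typed statement and its two implications, with the cubic corollary
  `erdosDivisorSumAsymptotic_cubic_of_meanSquare`.
-/

namespace Summit.Parity.BatemanHorn.Theorems

open Finset Polynomial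

/-! ### Pointwise content of the `ℓ¹` hypothesis -/

/-- **Pointwise content.**  `HooleyMeanLocal g θ η` gives, for every frequency `1 ≤ h ≤ E^θ` and every dyadic
range of moduli, `‖∑_{E<e≤E'} S_g(h;e)‖ + ‖∑_{E<e≤E'} S_g(−h;e)‖ ≤ C·h·E^{1−η}`: for bounded `h` a pointwise
power saving `η`. [this work] -/
theorem HooleyMeanLocal.pointwise {g : ℤ[X]} {θ η : ℝ} (hyp : HooleyMeanLocal g θ η) :
    ∃ C : ℝ, 0 ≤ C ∧ ∀ (E E' h : ℕ), 1 ≤ E → E ≤ E' → E' ≤ 2 * E → 1 ≤ h → (h : ℝ) ≤ (E : ℝ) ^ θ →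
      ‖∑ e ∈ Ioc E E', hooleySum g e h‖ + ‖∑ e ∈ Ioc E E', hooleySum g e (-(h : ℤ))‖
        ≤ C * h * (E : ℝ) ^ (1 - η) := by
  obtain ⟨C, hC0, hC⟩ := hyp.exists_nonneg
  refine ⟨C, hC0, fun E E' h hE hEE' hE' h1 hh => ?_⟩
  have hmem : h ∈ Icc 1 h := by simp [h1]
  calc ‖∑ e ∈ Ioc E E', hooleySum g e h‖ + ‖∑ e ∈ Ioc E E', hooleySum g e (-(h : ℤ))‖
      ≤ ∑ k ∈ Icc 1 h,
          (‖∑ e ∈ Ioc E E', hooleySum g e k‖ + ‖∑ e ∈ Ioc E E', hooleySum g e (-(k : ℤ))‖) :=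
        single_le_sum (s := Icc 1 h)
          (f := fun k : ℕ =>
            ‖∑ e ∈ Ioc E E', hooleySum g e k‖ + ‖∑ e ∈ Ioc E E', hooleySum g e (-(k : ℤ))‖)
          (fun k _ => by positivity) hmem
    _ ≤ C * h * (E : ℝ) ^ (1 - η) := hC E E' h hE hEE' hE' hh

/-- In particular at the lowest frequency `h = 1` (available as soon as `θ ≥ 0`):
`‖∑_{E<e≤E'} S_g(1;e)‖ ≤ C·E^{1−η}` on every dyadic range. [this work] -/
theorem HooleyMeanLocal.freq_one {g : ℤ[X]} {θ η : ℝ} (hθ : 0 ≤ θ) (hyp : HooleyMeanLocal g θ η) :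
    ∃ C : ℝ, 0 ≤ C ∧ ∀ E E' : ℕ, 1 ≤ E → E ≤ E' → E' ≤ 2 * E →
      ‖∑ e ∈ Ioc E E', hooleySum g e 1‖ ≤ C * (E : ℝ) ^ (1 - η) := by
  obtain ⟨C, hC0, hC⟩ := hyp.pointwise
  refine ⟨C, hC0, fun E E' hE hEE' hE' => ?_⟩
  have hE1 : (1 : ℝ) ≤ (E : ℝ) := by exact_mod_cast hE
  have h1 : ((1 : ℕ) : ℝ) ≤ (E : ℝ) ^ θ := by
    rw [Nat.cast_one]; exact Real.one_le_rpow hE1 hθ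
  have key := hC E E' 1 hE hEE' hE' le_rfl h1
  have hnn : 0 ≤ ‖∑ e ∈ Ioc E E', hooleySum g e (-((1 : ℕ) : ℤ))‖ := norm_nonneg _
  have : ‖∑ e ∈ Ioc E E', hooleySum g e ((1 : ℕ) : ℤ)‖ ≤ C * (E : ℝ) ^ (1 - η) := by
    have h' : C * ((1 : ℕ) : ℝ) * (E : ℝ) ^ (1 - η) = C * (E : ℝ) ^ (1 - η) := by
      rw [Nat.cast_one, mul_one]
    linarith
  simpa using this

/-! ### The second-moment form -/

/-- **The local mean-square hypothesis** with frequency range exponent `θ` and power saving `η`: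
`∃ C, ∀ 1 ≤ E ≤ E' ≤ 2E, ∀ H ≤ E^θ: ∑_{1≤h≤H} (‖∑_{E<e≤E'} S_g(h;e)‖² + ‖∑_{E<e≤E'} S_g(−h;e)‖²)
≤ C·H·E^{2(1−η)}`. [this work] -/
def HooleyMeanSquareLocal (g : ℤ[X]) (θ η : ℝ) : Prop :=
  ∃ C : ℝ, ∀ E E' H : ℕ, 1 ≤ E → E ≤ E' → E' ≤ 2 * E → (H : ℝ) ≤ (E : ℝ) ^ θ →
    ∑ h ∈ Icc 1 H,
        (‖∑ e ∈ Ioc E E', hooleySum g e h‖ ^ 2 + ‖∑ e ∈ Ioc E E', hooleySum g e (-(h : ℤ))‖ ^ 2)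
      ≤ C * H * (E : ℝ) ^ (2 * (1 - η))

/-- The constant may be taken nonnegative. [this work] -/
theorem HooleyMeanSquareLocal.exists_nonneg {g : ℤ[X]} {θ η : ℝ} (hyp : HooleyMeanSquareLocal g θ η) :
    ∃ C : ℝ, 0 ≤ C ∧ ∀ E E' H : ℕ, 1 ≤ E → E ≤ E' → E' ≤ 2 * E → (H : ℝ) ≤ (E : ℝ) ^ θ →
      ∑ h ∈ Icc 1 H,
          (‖∑ e ∈ Ioc E E', hooleySum g e h‖ ^ 2 + ‖∑ e ∈ Ioc E E', hooleySum g e (-(h : ℤ))‖ ^ 2)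
        ≤ C * H * (E : ℝ) ^ (2 * (1 - η)) := by
  obtain ⟨C, hC⟩ := hyp
  refine ⟨max C 0, le_max_right _ _, fun E E' H hE hEE' hE' hH => (hC E E' H hE hEE' hE' hH).trans ?_⟩
  have : 0 ≤ (H : ℝ) * (E : ℝ) ^ (2 * (1 - η)) := by positivity
  nlinarith [le_max_left C 0]

/-- An elementary Cauchy–Schwarz step: if `a_k, b_k ≥ 0` and `∑_{k∈s} (a_k² + b_k²) ≤ B`, then
`(∑_{k∈s} (a_k + b_k))² ≤ 2·#s·B`. [this work; folklore] -/
theorem sq_sum_add_le_of_sum_sq_le {s : Finset ℕ} {a b : ℕ → ℝ} {B : ℝ}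
    (hB : ∑ k ∈ s, (a k ^ 2 + b k ^ 2) ≤ B) :
    (∑ k ∈ s, (a k + b k)) ^ 2 ≤ 2 * s.card * B := by
  have hcs := sum_mul_sq_le_sq_mul_sq s (fun k => a k + b k) (fun _ => (1 : ℝ))
  have h1 : ∑ k ∈ s, (fun k => a k + b k) k * (fun _ => (1 : ℝ)) k = ∑ k ∈ s, (a k + b k) := by
    refine sum_congr rfl fun k _ => ?_
    simp
  have h2 : ∑ k ∈ s, (fun _ => (1 : ℝ)) k ^ 2 = s.card := by simp
  have h3 : ∑ k ∈ s, (fun k => a k + b k) k ^ 2 ≤ 2 * B := by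
    calc ∑ k ∈ s, (fun k => a k + b k) k ^ 2 ≤ ∑ k ∈ s, 2 * (a k ^ 2 + b k ^ 2) := by
          refine sum_le_sum fun k _ => ?_
          nlinarith [sq_nonneg (a k - b k)]
      _ = 2 * ∑ k ∈ s, (a k ^ 2 + b k ^ 2) := by rw [mul_sum]
      _ ≤ 2 * B := by linarith
  rw [h1, h2] at hcs
  have hcard : (0 : ℝ) ≤ s.card := by positivity
  calc (∑ k ∈ s, (a k + b k)) ^ 2 ≤ (∑ k ∈ s, (fun k => a k + b k) k ^ 2) * s.card := hcs
    _ ≤ 2 * B * s.card := mul_le_mul_of_nonneg_right h3 hcard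
    _ = 2 * s.card * B := by ring

/-- **Mean square ⇒ `ℓ¹` mean** (Cauchy–Schwarz), with the same exponents:
`HooleyMeanSquareLocal g θ η → HooleyMeanLocal g θ η`. [this work] -/
theorem hooleyMeanLocal_of_meanSquare {g : ℤ[X]} {θ η : ℝ} (hyp : HooleyMeanSquareLocal g θ η) :
    HooleyMeanLocal g θ η := by
  obtain ⟨C, hC0, hC⟩ := hyp.exists_nonneg
  refine ⟨Real.sqrt (2 * C), fun E E' H hE hEE' hE' hH => ?_⟩
  have key := hC E E' H hE hEE' hE' hH
  have hsq := sq_sum_add_le_of_sum_sq_le (s := Icc 1 H)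
    (a := fun k : ℕ => ‖∑ e ∈ Ioc E E', hooleySum g e k‖)
    (b := fun k : ℕ => ‖∑ e ∈ Ioc E E', hooleySum g e (-(k : ℤ))‖) key
  have hcard : ((Icc 1 H).card : ℝ) = H := by
    rw [Nat.card_Icc]; push_cast; ring
  rw [hcard] at hsq
  have hE0 : (0 : ℝ) ≤ (E : ℝ) := by positivity
  have hpow : (E : ℝ) ^ (2 * (1 - η)) = ((E : ℝ) ^ (1 - η)) ^ 2 := by
    rw [← Real.rpow_natCast ((E : ℝ) ^ (1 - η)) 2, ← Real.rpow_mul hE0]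
    push_cast; ring_nf
  have hS0 : 0 ≤ ∑ k ∈ Icc 1 H,
      (‖∑ e ∈ Ioc E E', hooleySum g e k‖ + ‖∑ e ∈ Ioc E E', hooleySum g e (-(k : ℤ))‖) :=
    sum_nonneg fun k _ => by positivity
  have hR0 : 0 ≤ Real.sqrt (2 * C) * H * (E : ℝ) ^ (1 - η) := by positivity
  have htarget : (∑ k ∈ Icc 1 H,
      (‖∑ e ∈ Ioc E E', hooleySum g e k‖ + ‖∑ e ∈ Ioc E E', hooleySum g e (-(k : ℤ))‖)) ^ 2
        ≤ (Real.sqrt (2 * C) * H * (E : ℝ) ^ (1 - η)) ^ 2 := by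
    have h2C : Real.sqrt (2 * C) ^ 2 = 2 * C := Real.sq_sqrt (by positivity)
    calc _ ≤ 2 * (H : ℝ) * (C * H * (E : ℝ) ^ (2 * (1 - η))) := hsq
      _ = (Real.sqrt (2 * C) * H * (E : ℝ) ^ (1 - η)) ^ 2 := by rw [hpow, mul_pow, mul_pow, h2C]; ring
  exact (pow_le_pow_iff_left₀ hS0 hR0 two_ne_zero).mp htarget

/-- **Uniform pointwise ⇒ mean square**: `HooleyUnshiftedUniform g η → HooleyMeanSquareLocal g θ η` for every
`θ ≤ 1` (each of the `2H` terms is at most `C²E^{2(1−η)}`). [this work] -/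
theorem hooleyMeanSquareLocal_of_unshiftedUniform {g : ℤ[X]} {θ η : ℝ} (hθ : θ ≤ 1)
    (hyp : HooleyUnshiftedUniform g η) : HooleyMeanSquareLocal g θ η := by
  obtain ⟨C, hC⟩ := hyp
  have hC0 : 0 ≤ C := by
    have h := hC 1 1 1 one_ne_zero le_rfl le_rfl (by norm_num) (by simp)
    have hn : 0 ≤ ‖∑ e ∈ Ioc 1 1, hooleySum g e 1‖ := norm_nonneg _
    have : C * ((1 : ℕ) : ℝ) ^ (1 - η) = C := by rw [Nat.cast_one, Real.one_rpow, mul_one]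
    linarith
  refine ⟨2 * C ^ 2, fun E E' H hE hEE' hE' hH => ?_⟩
  have hE1 : (1 : ℝ) ≤ (E : ℝ) := by exact_mod_cast hE
  have hE0 : (0 : ℝ) ≤ (E : ℝ) := by positivity
  have hHE : (H : ℝ) ≤ E := hH.trans (by
    calc (E : ℝ) ^ θ ≤ (E : ℝ) ^ (1 : ℝ) := Real.rpow_le_rpow_of_exponent_le hE1 hθ
      _ = E := Real.rpow_one _)
  have hpow : (E : ℝ) ^ (2 * (1 - η)) = ((E : ℝ) ^ (1 - η)) ^ 2 := by
    rw [← Real.rpow_natCast ((E : ℝ) ^ (1 - η)) 2, ← Real.rpow_mul hE0]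
    push_cast; ring_nf
  have hterm : ∀ k ∈ Icc 1 H,
      ‖∑ e ∈ Ioc E E', hooleySum g e k‖ ^ 2 + ‖∑ e ∈ Ioc E E', hooleySum g e (-(k : ℤ))‖ ^ 2
        ≤ 2 * (C * (E : ℝ) ^ (1 - η)) ^ 2 := by
    intro k hk
    rw [mem_Icc] at hk
    have hk1 : (1 : ℝ) ≤ k := by exact_mod_cast hk.1
    have hkH : (k : ℝ) ≤ H := by exact_mod_cast hk.2
    have hk0 : (k : ℤ) ≠ 0 := by have := hk.1; omega
    have hkE : |(k : ℤ)| ≤ E := by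
      rw [abs_of_nonneg (by positivity)]
      have : (k : ℝ) ≤ E := hkH.trans hHE
      exact_mod_cast this
    have hk0' : (-(k : ℤ)) ≠ 0 := neg_ne_zero.mpr hk0
    have hkE' : |(-(k : ℤ))| ≤ E := by rwa [abs_neg]
    have hp := hC k E E' hk0 hE hEE' hE' hkE
    have hm := hC (-(k : ℤ)) E E' hk0' hE hEE' hE' hkE'
    have hR : 0 ≤ C * (E : ℝ) ^ (1 - η) := by positivity
    have hp2 := pow_le_pow_left₀ (norm_nonneg _) hp 2
    have hm2 := pow_le_pow_left₀ (norm_nonneg _) hm 2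
    linarith
  calc ∑ k ∈ Icc 1 H,
        (‖∑ e ∈ Ioc E E', hooleySum g e k‖ ^ 2 + ‖∑ e ∈ Ioc E E', hooleySum g e (-(k : ℤ))‖ ^ 2)
      ≤ ∑ k ∈ Icc 1 H, 2 * (C * (E : ℝ) ^ (1 - η)) ^ 2 := sum_le_sum hterm
    _ = H * (2 * (C * (E : ℝ) ^ (1 - η)) ^ 2) := by
        rw [sum_const, Nat.card_Icc, nsmul_eq_mul]; push_cast; ring
    _ = 2 * C ^ 2 * H * (E : ℝ) ^ (2 * (1 - η)) := by rw [hpow]; ring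

/-- **Erdős's asymptotic for cubics from the mean-square hypothesis**: for an irreducible cubic `g`, if for some
`θ > 2/3` (`θ ≤ 1`) and `η > 1/3` the second moments satisfy
`∑_{1≤|h|≤H} |∑_{E<e≤E'} S_g(h;e)|² ≤ C·H·E^{2(1−η)}` for all `1 ≤ E ≤ E' ≤ 2E`, `H ≤ E^θ`, then
`∑_{n≤x} τ(g(n)) ~ 3·A_g·x log x`. [this work] -/
theorem erdosDivisorSumAsymptotic_cubic_of_meanSquare {g : ℤ[X]} (hirr : Irreducible g)
    (hdeg : g.natDegree = 3) {θ η : ℝ} (hθ : 2 / 3 < θ) (hθ1 : θ ≤ 1) (hη : 1 / 3 < η)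
    (hyp : HooleyMeanSquareLocal g θ η) : ErdosDivisorSumAsymptotic g :=
  erdosDivisorSumAsymptotic_cubic_of_hooleyMeanLocal hirr hdeg hθ hθ1 hη (hooleyMeanLocal_of_meanSquare hyp)

end Summit.Parity.BatemanHorn.Theorems
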